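import Mathlib.Tactic
import HarnessLib

/-!
# Kozma–Nitzan's Question 8 — UB(δ) for all depths via the per-class route; LEMMA Ψ-A (gen 47)

Support file (`--supports stmt-CriticalPhenomena-4575`, closed crux; independent mathematics on Kozma–Nitzan's Question 8,
arXiv:2401.12397 §5.5 p. 36), prover `prim-ineq-gen-6` (gen 47).  No definitions, no named facts, no sorries; standard axioms.
Memo `run/shared/lean/prim/prim-ineq-gen-6/PROOF-PSIA-G47.md`.

UB(δ) (the cap `δ_j ≤ c·μ̂^_j` on the two-level subtree balance of every class of a path-end block with `c > 0`) is
equivalent to `Λ_j ≤ c·μ̂^_j` (`Λ_j = ψ_j + Σ_{k<j} r_{k,j} δ_k`), and with the slacks `e_k := c·μ̂^_k − δ_k` of the children one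
has the exact identity `c·μ̂^_j − Λ_j = φ_j + Σ_{k<j} r_{k,j} e_k` (`φ_j = c·μ̂_j − ψ_j` the per-class slack) — kernel
`kUBd_perclass_identity`.  Hence UB(δ) at every class follows by induction on the class from THEOREM UB (`ĝ_j ≥ 0`) and the
per-class statement CONJ Ψ′: `δ_j > 0 ⟹ φ_j ≥ 0` (kernels `kUBd_perclass_step`, `kUBd_perclass_nonpos`).
LEMMA Ψ-A (this generation, exact 9-variable Positivstellensatz certificate, kit evidence on the item) proves the U-type half:
`U_j > 0 ⟹ φ_j ≥ 0`.  Its hypotheses are obtained from gen 27's reduction identity `−U_j/s_{j+1} = u″L̃_j + v″R̃_j − Γ_j u″v″`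
and the lower bounds `L̃_j ≥ L₀ ≥ 0`, `R̃_j ≥ R₀ ≥ 0` by the elementary kernel `kPsiA_hyp`; `kPsiA_nearC` is the class-by-class
inequality behind the near-moment cut `γ_j·D_near ≤ (1−γ_j)·m_near`, and `kPsiA_theta` the decomposition of the slack bracket
`(K₄+Φσ)p − Φσ = (K₄+Φσ)(p−Φ) + Φ(1−Φ)D` used to read the certificate.
[cite: KozmaNitzan2024, Question 8 (§5.5 p. 36)]
-/

namespace Summit.CriticalPhenomena.PercolationContinuityZ3.Theorems

namespace PocketCert

open Finset

/-- **Per-class identity behind UB(δ).**  With `μ̂^_j = μ̂_j + Σ_k r_k μ̂^_k`, `Λ_j = ψ_j + Σ_k r_k δ_k`, `φ_j = c·μ̂_j − ψ_j`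
and the children's slacks `e_k = c·μ̂^_k − δ_k`:  `c·μ̂^_j − Λ_j = φ_j + Σ_k r_k e_k`.
[cite: KozmaNitzan2024, Question 8 (§5.5 p. 36)] -/
theorem kUBd_perclass_identity {ι : Type*} (s : Finset ι) (c mu psi : ℝ) (r muh delta : ι → ℝ) :
    c * (mu + ∑ k ∈ s, r k * muh k) - (psi + ∑ k ∈ s, r k * delta k)
      = (c * mu - psi) + ∑ k ∈ s, r k * (c * muh k - delta k) := by
  have h1 : ∑ k ∈ s, r k * (c * muh k - delta k) = c * ∑ k ∈ s, r k * muh k - ∑ k ∈ s, r k * delta k := by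
    rw [Finset.mul_sum, ← Finset.sum_sub_distrib]
    refine Finset.sum_congr rfl ?_
    intro k _
    ring
  rw [h1]; ring

/-- **Per-class step (positive class).**  If the per-class slack `φ_j ≥ 0`, the children's slacks `e_k ≥ 0` enter with
nonnegative tree ratios `r_k ≥ 0`, and `ĝ_j ≥ 0` (THEOREM UB), then `e_j = min(ĝ_j, φ_j + Σ_k r_k e_k) ≥ 0`, i.e. `δ_j ≤ c·μ̂^_j`.
[cite: KozmaNitzan2024, Question 8 (§5.5 p. 36)] -/
theorem kUBd_perclass_step {ι : Type*} (s : Finset ι) (phi ghat : ℝ) (r e : ι → ℝ)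
    (hphi : 0 ≤ phi) (hg : 0 ≤ ghat) (hr : ∀ k ∈ s, 0 ≤ r k) (he : ∀ k ∈ s, 0 ≤ e k) :
    0 ≤ min ghat (phi + ∑ k ∈ s, r k * e k) := by
  have hs : 0 ≤ ∑ k ∈ s, r k * e k := Finset.sum_nonneg (fun k hk => mul_nonneg (hr k hk) (he k hk))
  exact le_min hg (by linarith)

/-- **Per-class step (nonpositive class).**  If `δ_j ≤ 0 ≤ c·μ̂^_j` then the slack `e_j = c·μ̂^_j − δ_j ≥ 0` trivially; together
with `kUBd_perclass_step` this is the induction UB(δ) ⟸ [CONJ Ψ′: `δ_j > 0 ⟹ φ_j ≥ 0`] ∧ THEOREM UB.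
[cite: KozmaNitzan2024, Question 8 (§5.5 p. 36)] -/
theorem kUBd_perclass_nonpos (cmuh delta : ℝ) (hd : delta ≤ 0) (hc : 0 ≤ cmuh) : 0 ≤ cmuh - delta := by
  linarith

/-- **Hypotheses of LEMMA Ψ-A from positivity.**  At a depth with `U_j > 0`, gen 27's reduction identity reads
`u″·L̃ + v″·R̃ < Γ·u″·v″` with `u″, v″ ≥ 0`; if `L̃ ≥ L₀ ≥ 0` and `R̃ ≥ R₀ ≥ 0` (LEMMA 1 COROLLARY + PROPOSITION H of gen 27) then
`L₀ < Γ·v″` and `R₀ < Γ·u″` — the two polynomial hypotheses `H1, H2` of the Ψ-A certificate (and `u″, v″ > 0`).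
[cite: KozmaNitzan2024, Question 8 (§5.5 p. 36)] -/
theorem kPsiA_hyp (u v L R L0 R0 Γ : ℝ) (hu : 0 ≤ u) (hv : 0 ≤ v) (hL : L0 ≤ L) (hR : R0 ≤ R) (hL0 : 0 ≤ L0) (hR0 : 0 ≤ R0)
    (hneg : u * L + v * R < Γ * u * v) : L0 < Γ * v ∧ R0 < Γ * u := by
  have h1 : u * L0 + v * R0 < Γ * u * v := by nlinarith [mul_le_mul_of_nonneg_left hL hu, mul_le_mul_of_nonneg_left hR hv]
  have hupos : 0 < u := by
    rcases lt_or_eq_of_le hu with h | h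
    · exact h
    · exfalso; rw [← h] at h1; nlinarith [mul_nonneg hv hR0]
  have hvpos : 0 < v := by
    rcases lt_or_eq_of_le hv with h | h
    · exact h
    · exfalso; rw [← h] at h1; nlinarith [mul_nonneg hu hL0]
  constructor
  · rcases lt_or_ge L0 (Γ * v) with h | hc
    · exact h
    · exfalso; nlinarith [mul_le_mul_of_nonneg_left hc hu, mul_nonneg hv hR0]
  · rcases lt_or_ge R0 (Γ * u) with h | hc
    · exact h
    · exfalso; nlinarith [mul_le_mul_of_nonneg_left hc hv, mul_nonneg hu hL0]

/-- **Near-moment cut, class by class.**  Along the classes `k ≤ j` of a block the cumulative C-mark is non-increasing, `γ_j ≤ γ_k`;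
hence the class-`k` C-defect `a_k(1−γ_k)p_k` and the class-`k` both-good mass `a_kγ_kp_k` satisfy
`γ_j · a_k(1−γ_k)p_k ≤ (1−γ_j) · a_kγ_kp_k`.  Summing with the class weights gives the cut `γ_j·D_near ≤ (1−γ_j)·m_near`
(and symmetrically `a_j·u_near ≤ (1−a_j)·m_near`) used by the Ψ-A certificate.  [cite: KozmaNitzan2024, Question 8 (§5.5 p. 36)] -/
theorem kPsiA_nearC (gj gk a p : ℝ) (hjk : gj ≤ gk) (hap : 0 ≤ a * p) :
    gj * (a * (1 - gk) * p) ≤ (1 - gj) * (a * gk * p) := by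
  have : gj * (1 - gk) ≤ (1 - gj) * gk := by nlinarith
  nlinarith [mul_le_mul_of_nonneg_left this hap]

/-- **The slack bracket.**  With `K₄ = (Φ+m)(1−Φ)`, `σ = π + m` and `D = Φ − π` (so `Φ = ε + π − m`, `D = ε − m`):
`(K₄ + Φσ)·p − Φσ = (K₄ + Φσ)(p − Φ) + Φ(1−Φ)·D`; both terms are nonnegative on a block (`p_j ≥ Φ`, `D ≥ 0`), which is the
structure read off by the Ψ-A certificate (`φ_j = a_jγ_j[(K₄+Φσ)p_j − Φσ] − c·p_j·n_j`).  [cite: KozmaNitzan2024, Question 8 (§5.5 p. 36)] -/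
theorem kPsiA_theta (Φ m π p K₄ σ D : ℝ) (hK : K₄ = (Φ + m) * (1 - Φ)) (hσ : σ = π + m) (hD : D = Φ - π) :
    (K₄ + Φ * σ) * p - Φ * σ = (K₄ + Φ * σ) * (p - Φ) + Φ * (1 - Φ) * D := by
  subst hK hσ hD; ring

/-- **LEMMA Ψ-C1, step (ii): the rest-probability gap of a C-perfect prefix.**  If `γ_j = 1` the block's `Φ` decomposes as
`Φ = Φ_near + ω_j p + S·(p − (1−a)v″)` (near classes, class `j`, and the far part `S·Φ(T″[a,1]) = S(m″ + a v″ + u″)`, `p = u″+v″+m″`),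
with `Φ_near ≤ p(1 − S_j)` and `ω_j + S = S_j`; hence `p − Φ ≥ S(1−a)v″`.  [cite: KozmaNitzan2024, Question 8 (§5.5 p. 36)] -/
theorem kPsiC1_gap (Φ Φn ω S Sj p a v : ℝ) (hΦ : Φ = Φn + ω * p + S * (p - (1 - a) * v)) (hn : Φn ≤ p * (1 - Sj))
    (hS : ω + S = Sj) : S * (1 - a) * v ≤ p - Φ := by
  have h1 : Φ ≤ p * (1 - Sj) + ω * p + S * (p - (1 - a) * v) := by rw [hΦ]; linarith
  have h2 : p * (1 - Sj) + ω * p + S * p = p := by rw [← hS]; ring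
  nlinarith

/-- **LEMMA Ψ-C1, step (iv): `π ≤ K₄ + Φσ`.**  With `K₄ = (Φ+m)(1−Φ)`, `σ = π + m`, `0 ≤ m`, `π ≤ Φ ≤ 1`:  `π ≤ (Φ+m)(1−Φ) + Φ(π+m)`,
hence `ϖ·p ≤ πΦ·1 ≤ Φ(K₄ + Φσ)`.  [cite: KozmaNitzan2024, Question 8 (§5.5 p. 36)] -/
theorem kPsiC1_pi (Φ m π : ℝ) (hm : 0 ≤ m) (hπ : π ≤ Φ) (hΦ : Φ ≤ 1) :
    π ≤ (Φ + m) * (1 - Φ) + Φ * (π + m) := by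
  nlinarith [mul_nonneg hm (sub_nonneg.mpr hΦ), mul_le_mul_of_nonneg_right hπ (sub_nonneg.mpr hΦ)]

/-- **LEMMA Ψ-C1 (C-perfect prefix ⟹ nonnegative per-class slack), assembly.**  At a class `j` with `γ_j = 1` one has `n_j = 1 − a`,
`D = S·a·v″` (no near C-defect), `cΦ = Dϖ`; with step (ii) `S(1−a)v″ ≤ p − Φ`, the bracket bound `(K₄+Φσ)(p−Φ) ≤ Θ` (kernel `kPsiA_theta`,
`D ≥ 0`) and step (iv) in the form `ϖp ≤ Φ(K₄+Φσ)`:  `c·p·(1−a) ≤ a·Θ`, i.e. `φ_j = aΘ − c p (1−a) ≥ 0` — for EVERY block, no positivity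
hypothesis.  [cite: KozmaNitzan2024, Question 8 (§5.5 p. 36)] -/
theorem kPsiC1 (a S v ϖ Φ p K Θ D c : ℝ) (hΦ : 0 < Φ) (ha0 : 0 ≤ a) (ha1 : a ≤ 1) (hS : 0 ≤ S) (hv : 0 ≤ v) (hK : 0 ≤ K)
    (hc : c * Φ = D * ϖ) (hD : D = S * a * v) (hgap : S * (1 - a) * v ≤ p - Φ) (hΘ : K * (p - Φ) ≤ Θ) (hϖp : ϖ * p ≤ Φ * K) :
    c * p * (1 - a) ≤ a * Θ := by
  -- Φ·[c p (1−a)] = S a v ϖ p (1−a) ≤ S a v (1−a) Φ K ≤ a Φ K (p − Φ) ≤ a Φ Θ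
  have e1 : Φ * (c * p * (1 - a)) = S * a * v * (ϖ * p) * (1 - a) := by
    have : c * Φ * p * (1 - a) = D * ϖ * p * (1 - a) := by rw [hc]
    rw [hD] at this; nlinarith [this]
  have hsav : 0 ≤ S * a * v * (1 - a) := by
    have := mul_nonneg (mul_nonneg (mul_nonneg hS ha0) hv) (sub_nonneg.mpr ha1); linarith
  have e2 : S * a * v * (ϖ * p) * (1 - a) ≤ S * a * v * (Φ * K) * (1 - a) := by nlinarith [mul_le_mul_of_nonneg_left hϖp hsav]
  have e3 : S * a * v * (Φ * K) * (1 - a) = a * Φ * K * (S * (1 - a) * v) := by ring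
  have e4 : a * Φ * K * (S * (1 - a) * v) ≤ a * Φ * K * (p - Φ) :=
    mul_le_mul_of_nonneg_left hgap (mul_nonneg (mul_nonneg ha0 hΦ.le) hK)
  have e5 : a * Φ * (K * (p - Φ)) ≤ a * Φ * Θ := mul_le_mul_of_nonneg_left hΘ (mul_nonneg ha0 hΦ.le)
  have : Φ * (c * p * (1 - a)) ≤ Φ * (a * Θ) := by nlinarith
  exact le_of_mul_le_mul_left this hΦ

/-- **UB(δ) from CONJ Ψ′ — the whole induction, abstractly.**  Let the classes `0,1,2,…` of a block carry: tree ratios `r k j ≥ 0`, the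
THEOREM-UB slacks `ĝ_j ≥ 0`, the caps `cμ̂^_j ≥ 0` (c > 0), the balances `δ_j`, the per-class slacks `φ_j`, and the UB(δ)-slacks
`e_j = cμ̂^_j − δ_j`, which by `kUBd_perclass_identity` satisfy the cascade `e_j = min(ĝ_j, φ_j + Σ_{k<j} r k j · e_k)`.  If every
δ-positive class has `φ_j ≥ 0` (CONJ Ψ′; proved for U-positive classes = LEMMA Ψ-A, for C-shallow classes = LEMMA Ψ-H, for
C-perfect prefixes = LEMMA Ψ-C1), then `e_j ≥ 0`, i.e. `δ_j ≤ cμ̂^_j`, at EVERY class (strong induction on the class).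
[cite: KozmaNitzan2024, Question 8 (§5.5 p. 36)] -/
theorem kUBd_perclass_induction (e phi ghat cmuh delta : ℕ → ℝ) (r : ℕ → ℕ → ℝ)
    (hr : ∀ k j, 0 ≤ r k j) (hg : ∀ j, 0 ≤ ghat j) (hc : ∀ j, 0 ≤ cmuh j)
    (he : ∀ j, e j = min (ghat j) (phi j + ∑ k ∈ Finset.range j, r k j * e k))
    (hd : ∀ j, e j = cmuh j - delta j) (hpsi : ∀ j, 0 < delta j → 0 ≤ phi j) : ∀ j, 0 ≤ e j := by
  intro j
  induction j using Nat.strong_induction_on with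
  | _ j ih =>
    by_cases hδ : 0 < delta j
    · rw [he j]
      have hs : 0 ≤ ∑ k ∈ Finset.range j, r k j * e k :=
        Finset.sum_nonneg (fun k hk => mul_nonneg (hr k j) (ih k (Finset.mem_range.mp hk)))
      exact le_min (hg j) (by linarith [hpsi j hδ])
    · rw [hd j]; push Not at hδ; linarith [hc j]

end PocketCert

end Summit.CriticalPhenomena.PercolationContinuityZ3.Theorems
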